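import Mathlib
import Summits.KontsevichZagierPeriods.Zeta5Search.ProfileA5p2736CellsA
import Summits.KontsevichZagierPeriods.Zeta5Search.ProfileA5p2736CellsB
import Summits.KontsevichZagierPeriods.Zeta5Search.ProfileA5p1735CellsA
import Summits.KontsevichZagierPeriods.Zeta5Search.ProfileA5p1735CellsB
import Summits.KontsevichZagierPeriods.Zeta5Search.ProfileA5p172635CellsA
import Summits.KontsevichZagierPeriods.Zeta5Search.ProfileA5p172635CellsB
import Summits.KontsevichZagierPeriods.Zeta5Search.DenomLaw.Profile15aPath
import Summits.KontsevichZagierPeriods.Zeta5Search.DenomLaw.PathWeightProfile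
import Summits.KontsevichZagierPeriods.Zeta5Search.DenomLaw.VGainPalCoverKit
import Summits.KontsevichZagierPeriods.Zeta5Search.DenomLaw.Profile11PathA
import Summits.KontsevichZagierPeriods.Zeta5Search.DenomLaw.LawA3KCoverKit
import Summits.KontsevichZagierPeriods.Zeta5Search.DenomLaw.LawA4CoverKit
import Summits.KontsevichZagierPeriods.Zeta5Search.DenomLaw.Profile11PathB
import Summits.KontsevichZagierPeriods.Zeta5Search.DenomLaw.Profile12PathC
import Summits.KontsevichZagierPeriods.Zeta5Search.DenomLaw.Profile8PathA
import Summits.KontsevichZagierPeriods.Zeta5Search.DenomLaw.ProfileA5PathE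
import Summits.KontsevichZagierPeriods.Zeta5Search.DenomLaw.ProfileA5PathG
import HarnessLib

/-!
# ζ(5) search — a < 7 PROFILES `A5P2736`, `A5P1735`, `A5P172635` for EVERY sorted parameter vector at depth `d < 2p` (DENOM-LAW D1, prover-d1 gen 24; generated by gen 23's `gen_pathGEN.py` + gen 24's LB♯ / J laws)

Cell `pub-zeta5` (HONEST FRAMING: systematic search; no irrationality claim unless certified), TRACK «DENOM-LAW» D1 prover seat (denom-prover-d1
gen 23, `HOME/denom-law/prover-d1/ATTEMPT-23.md`; path generator `g23/gen/path23/gen_pathGEN.py`, cover specs `g23/gen/specs/`).  The a = 6 stratum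
(`b₇ < p ≤ b₆`: 9,264 / 13,757 first-period instances at p = 7 / 11) after `ProfileA6TopPath` / `ProfileA6u47Path`: the profiles `A5P2736`, `A5P1735`, `A5P172635` (long pair blocks =
the up-sets generated by the pairs named in each section; 17 + 17 + 17 instances at p = 7), each with ONE law at every depth read off its machine-generated covers
(`decide` on the whole type lists, covers complete for every `p`): `A5P2736`: THEOREM LB `(A,B) = (-4, -1, -1)`; `A5P1735`: the V-gain with palindromic rows `vgainPal_of_cover` (`N = 6`, `R = -1`); `A5P172635`: the V-gain with palindromic rows `vgainPal_of_cover` (`N = 6`, `R = -2`).  The node `⌊d/p⌋ − N_p − min([⌊d/p⌋ ≥ 2], 5 − C⋆)` is met at `⌊d/p⌋ ≤ 1`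
(`C⋆` by new finite checks with six long parameters); the theorems carry `d < 2p` (the depth `⌊d/p⌋ = 2` of these profiles is left open).  p-UNIFORM
hypotheses (lead l.9565): stratum + ORDER conditions + depth only.  Results: `pathAccounting_profile<X>` (every `j`) and
`pathAccountingFirstPeriod_profile<X>`.  MODEL/structure-side valuation bookkeeping of the cell's own rationals; nothing about ζ(5); no γ; records
in print UNMOVED.
-/

open Finset

namespace Summit.KontsevichZagierPeriods.Zeta5Search.FullProfile

open Summit.KontsevichZagierPeriods.Zeta5Search.ClusterValuation
open Summit.KontsevichZagierPeriods.Zeta5Search.CasoratianValuation (InPolytope shift casoratian pairFloors refund)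
open Summit.KontsevichZagierPeriods.Zeta5Search.WedgeDictionary (dOf)
open Summit.KontsevichZagierPeriods.Zeta5Search.ClassTypeCover
open Summit.KontsevichZagierPeriods.Zeta5Search.DenomLaw (cStar FirstPeriod Sorted7 vgain_of_cover vgainPal_of_cover cover_A3K cover_A4)
open Summit.KontsevichZagierPeriods.Zeta5Search.DenomLaw.FirstPeriodKit (sorted7_chain firstPeriod_pair pairFloors_expand)
open Summit.KontsevichZagierPeriods.Zeta5Search.SortedProfile
/-! ## The a = 5 profile `A5P2736`: long pair blocks generated by [(2, 7), (3, 6)] (maximal short [(1, 7), (2, 6), (4, 5)]); `N_p = 8`, `C⋆ ≤ 7` -/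

section A5P2736

variable {b : ℕ → ℤ} {j p : ℕ}

/-- **THEOREM LB on `A5P2736`, general `b`, any depth**: `v_p(Cas_j(b)) ≥ -5` (`(A, B) = (-4, -1)`, `B ≤ 0`; gen 22's `casLB_ge_of_cover_le0`), and
`≥ -5` at `p ≤ d` (`(A, B) = (-4, -1)`, `casLB_ge_of_cover`). -/
theorem cas_geA5P2736 (hb : InPolytope b) (hs : Sorted7 b) (hbj : InPolytope (shift b j)) (hj1 : 1 ≤ j) (hj7 : j ≤ 7)
    (hprime : p.Prime) (hp5 : 5 ≤ p) (hwin : (b 0 + 2 : ℤ) < (p : ℤ) ^ 2) (hA : b 6 < (p : ℤ)) (hA5 : (p : ℤ) ≤ b 5) (hL27 : (p : ℤ) + b 2 + b 7 ≤ b 0) (hL36 : (p : ℤ) + b 3 + b 6 ≤ b 0) (hS17 : b 0 < (p : ℤ) + b 1 + b 7) (hS26 : b 0 < (p : ℤ) + b 2 + b 6) (hS45 : b 0 < (p : ℤ) + b 4 + b 5)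
    (hF1 : b 1 < 2 * (p : ℤ)) (hF2 : b 0 < 2 * (p : ℤ) + b 6 + b 7) (hcas : casoratian b j ≠ 0) :
    -5 + (if (p : ℤ) ≤ dOf b then (0 : ℤ) else 0) ≤ padicValRat p (casoratian b j) := by
  haveI : Fact p.Prime := ⟨hprime⟩
  have hp2 : p % 2 = 1 := Nat.odd_iff.1 (hprime.odd_of_ne_two (by omega))
  have hv := casoratianClassBound_holds b j p hb hj1 hj7 hbj hprime hp5 hwin hcas
  by_cases hpd : (p : ℤ) ≤ dOf b
  · rw [if_pos hpd]
    rcases Int.emod_two_eq_zero_or_one (b 0) with hr | hr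
    · rcases casLB_ge_of_cover (coverA5P2736_ev hb hs hA hA5 hL27 hL36 hS17 hS26 hS45 hF1 hF2 hp5 hp2 hr) (A := -4) (B := -1) (by rw [oddFlag_false hr]; decide) (by norm_num) hpd with h0 | h
      · rw [h0] at hv; push_cast; linarith
      · push_cast; linarith
    · rcases casLB_ge_of_cover (coverA5P2736_od hb hs hA hA5 hL27 hL36 hS17 hS26 hS45 hF1 hF2 hp5 hp2 hr) (A := -4) (B := -1) (by rw [oddFlag_true hr]; decide) (by norm_num) hpd with h0 | h
      · rw [h0] at hv; push_cast; linarith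
      · push_cast; linarith
  · rw [if_neg hpd]
    rcases Int.emod_two_eq_zero_or_one (b 0) with hr | hr
    · rcases casLB_ge_of_cover_le0 (coverA5P2736_ev hb hs hA hA5 hL27 hL36 hS17 hS26 hS45 hF1 hF2 hp5 hp2 hr) (A := -4) (B := -1) (by rw [oddFlag_false hr]; decide) (by norm_num) with h0 | h
      · rw [h0] at hv; push_cast; linarith
      · push_cast; linarith
    · rcases casLB_ge_of_cover_le0 (coverA5P2736_od hb hs hA hA5 hL27 hL36 hS17 hS26 hS45 hF1 hF2 hp5 hp2 hr) (A := -4) (B := -1) (by rw [oddFlag_true hr]; decide) (by norm_num) with h0 | h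
      · rw [h0] at hv; push_cast; linarith
      · push_cast; linarith

/-- **`PathAccountingFirstPeriod`'s conclusion on `A5P2736`, EVERY sorted `b`, every direction `j`, depth `d < 2p`** (`N_p = 8`, `C⋆ ≤ 7`; node `-6` at
`⌊d/p⌋ = 0`, `-5` at `⌊d/p⌋ = 1`). -/
theorem pathAccounting_profileA5P2736 (b : ℕ → ℤ) (j p : ℕ) (hb : InPolytope b) (hs : Sorted7 b) (hbj : InPolytope (shift b j))
    (hj1 : 1 ≤ j) (hj7 : j ≤ 7) (hprime : p.Prime) (hp5 : 5 ≤ p) (hwin : (b 0 + 2 : ℤ) < (p : ℤ) ^ 2) (hfp : FirstPeriod b p)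
    (hA : b 6 < (p : ℤ)) (hA5 : (p : ℤ) ≤ b 5) (hL27 : (p : ℤ) + b 2 + b 7 ≤ b 0) (hL36 : (p : ℤ) + b 3 + b 6 ≤ b 0) (hS17 : b 0 < (p : ℤ) + b 1 + b 7) (hS26 : b 0 < (p : ℤ) + b 2 + b 6) (hS45 : b 0 < (p : ℤ) + b 4 + b 5) (hd2 : dOf b < 2 * (p : ℤ))
    (hcas : casoratian b j ≠ 0) :
    dOf b / (p : ℤ) - pairFloors b p - min (if 2 ≤ dOf b / (p : ℤ) then (1 : ℤ) else 0) (5 - (cStar b p : ℤ))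
      ≤ padicValRat p (casoratian b j) := by
  obtain ⟨hF1, hF2⟩ := fp_bounds hfp
  have hp0 : (0 : ℤ) < p := by exact_mod_cast hprime.pos
  have hpf : pairFloors b p = 8 := by
    obtain ⟨h21, h32, h43, h54, h65, h76⟩ := sorted7_chain hs
    exact pairFloors_eq_8d hb hs hprime.pos hS17 hS26 hS45 hL27 hL36 hfp
  rw [hpf]
  have hC : (cStar b p : ℤ) ≤ 7 := by exact_mod_cast cStar_le_seven_A5P26 hs hA hS17 hS45
  have hfd : dOf b / (p : ℤ) < 2 := by rw [Int.ediv_lt_iff_lt_mul hp0]; linarith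
  rw [if_neg (by omega)]
  have hmin : -2 ≤ min (0 : ℤ) (5 - (cStar b p : ℤ)) := le_min (by norm_num) (by linarith)
  have hlaw := cas_geA5P2736 hb hs hbj hj1 hj7 hprime hp5 hwin hA hA5 hL27 hL36 hS17 hS26 hS45 hF1 hF2 hcas
  by_cases h1 : (p : ℤ) ≤ dOf b
  · have hfd1 : dOf b / (p : ℤ) ≤ 1 := by omega
    rw [if_pos h1] at hlaw
    linarith
  · rw [if_neg h1] at hlaw
    push Not at h1
    have hd0 : 0 ≤ dOf b := by have := hb.2.2; unfold dOf; linarith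
    have hfd0 : dOf b / (p : ℤ) = 0 := Int.ediv_eq_zero_of_lt hd0 h1
    rw [hfd0]
    linarith

/-- **THE NODE ON `A5P2736` AT DEPTH `d < 2p`, EVERY SORTED `b`: `PathAccountingFirstPeriod` with its binders VERBATIM plus `b_6 < p ≤ b_5`, the profile's
ORDER conditions and `d < 2p`.** -/
theorem pathAccountingFirstPeriod_profileA5P2736 :
    ∀ (b : ℕ → ℤ) (p : ℕ), InPolytope b → Sorted7 b → InPolytope (shift b 7) →
      p.Prime → 5 ≤ p → (b 0 + 2 : ℤ) < (p : ℤ) ^ 2 → FirstPeriod b p →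
      b 6 < (p : ℤ) → (p : ℤ) ≤ b 5 → (p : ℤ) + b 2 + b 7 ≤ b 0 → (p : ℤ) + b 3 + b 6 ≤ b 0 → b 0 < (p : ℤ) + b 1 + b 7 → b 0 < (p : ℤ) + b 2 + b 6 → b 0 < (p : ℤ) + b 4 + b 5 → dOf b < 2 * (p : ℤ) → casoratian b 7 ≠ 0 →
        dOf b / (p : ℤ) - pairFloors b p - min (if 2 ≤ dOf b / (p : ℤ) then (1 : ℤ) else 0) (5 - (cStar b p : ℤ))
          ≤ padicValRat p (casoratian b 7) :=
  fun b p hb hs hb7 hprime hp5 hwin hfp hA hA5 hL27 hL36 hS17 hS26 hS45 hd2 hcas =>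
    pathAccounting_profileA5P2736 b 7 p hb hs hb7 (by norm_num) (by norm_num) hprime hp5 hwin hfp hA hA5 hL27 hL36 hS17 hS26 hS45 hd2 hcas

end A5P2736

/-! ## The a = 5 profile `A5P1735`: long pair blocks generated by [(1, 7), (3, 5)] (maximal short [(2, 6), (3, 4)]); `N_p = 11`, `C⋆ ≤ 9` -/

section A5P1735

variable {b : ℕ → ℤ} {j p : ℕ}

/-- **`C⋆ ≤ 9` on `A5P1735`** (5 long parameters `b_6 < p ≤ b_5`; every pair block below one of the short pairs [(2, 6), (3, 4)] is short): the finite check over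
the 5,040 orderings (`decide +kernel`). -/
theorem cStar_le_nine_A5P1735 {b : ℕ → ℤ} {p : ℕ} (hs : Sorted7 b) (hA : b 6 < (p : ℤ)) (hS26 : b 0 < (p : ℤ) + b 2 + b 6) (hS34 : b 0 < (p : ℤ) + b 3 + b 4) : cStar b p ≤ 9 := by
  obtain ⟨h21, h32, h43, h54, h65, h76⟩ := sorted7_chain hs
  refine DenomLaw.FirstPeriodKit.cStar_le_of_profile (fun i => i.val + 1 ≤ 5)
    (fun i k => ¬ (((i.val + 1 ≤ 2 ∧ k.val + 1 ≤ 6) ∨ (k.val + 1 ≤ 2 ∧ i.val + 1 ≤ 6) ∨ (i.val + 1 ≤ 3 ∧ k.val + 1 ≤ 4) ∨ (k.val + 1 ≤ 3 ∧ i.val + 1 ≤ 4)) ∧ i.val ≠ k.val)) 9 ?_ ?_ (by decide +kernel)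
  · intro i h
    have := i.isLt
    by_contra hc
    interval_cases hv : i.val <;> simp only [Nat.reduceAdd] at h hc <;> omega
  · intro i k hik h
    obtain ⟨hsh, hne⟩ := h
    have := i.isLt; have := k.isLt
    exfalso
    rcases hsh with ⟨h1, h2⟩ | ⟨h1, h2⟩ | ⟨h1, h2⟩ | ⟨h1, h2⟩ <;> interval_cases hv : i.val <;> interval_cases hw : k.val <;> simp only [Nat.reduceAdd] at hik h1 h2 <;> omega

/-- **The V-GAIN law on `A5P1735`, general `b`, every depth**: `v_p(Cas_j(b)) ≥ -6`, and `≥ -6` for `p ≤ d` (gen 10's `checkB` at `N = 6` and the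
row check at `R = -1`, `decide`d on both covers; gen 23's `DenomLaw.vgainPal_of_cover`). -/
theorem cas_geA5P1735 (hb : InPolytope b) (hs : Sorted7 b) (hbj : InPolytope (shift b j)) (hj1 : 1 ≤ j) (hj7 : j ≤ 7)
    (hprime : p.Prime) (hp5 : 5 ≤ p) (hwin : (b 0 + 2 : ℤ) < (p : ℤ) ^ 2) (hA : b 6 < (p : ℤ)) (hA5 : (p : ℤ) ≤ b 5) (hL17 : (p : ℤ) + b 1 + b 7 ≤ b 0) (hL35 : (p : ℤ) + b 3 + b 5 ≤ b 0) (hS26 : b 0 < (p : ℤ) + b 2 + b 6) (hS34 : b 0 < (p : ℤ) + b 3 + b 4)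
    (hF1 : b 1 < 2 * (p : ℤ)) (hF2 : b 0 < 2 * (p : ℤ) + b 6 + b 7) (hcas : casoratian b j ≠ 0) :
    -6 + (if (p : ℤ) ≤ dOf b then (0 : ℤ) else 0) ≤ padicValRat p (casoratian b j) := by
  haveI : Fact p.Prime := ⟨hprime⟩
  have hp2 : p % 2 = 1 := Nat.odd_iff.1 (hprime.odd_of_ne_two (by omega))
  obtain ⟨h21, h32, h43, h54, h65, h76⟩ := sorted7_chain hs
  obtain ⟨h0, hb1, hb2, hb3, hb4, hb5, hb6, hb7, hc1⟩ := box hb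
  have hpb : (p : ℤ) ≤ b 0 := by linarith
  have hmin : min (-1 : ℤ) 0 = -1 := by norm_num
  rcases Int.emod_two_eq_zero_or_one (b 0) with hr | hr
  · have h := vgainPal_of_cover hb hj1 hj7 hbj hp5 hpb hwin (coverA5P1735_ev hb hs hA hA5 hL17 hL35 hS26 hS34 hF1 hF2 hp5 hp2 hr) (N := 6) (by norm_num) ⟨3, rfl⟩
      (by rw [oddFlag_false hr]; decide) (-1) (by norm_num) (by rw [oddFlag_false hr]; decide) hcas
    rw [hmin] at h; push_cast at h; split_ifs at h ⊢ <;> linarith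
  · have h := vgainPal_of_cover hb hj1 hj7 hbj hp5 hpb hwin (coverA5P1735_od hb hs hA hA5 hL17 hL35 hS26 hS34 hF1 hF2 hp5 hp2 hr) (N := 6) (by norm_num) ⟨3, rfl⟩
      (by rw [oddFlag_true hr]; decide) (-1) (by norm_num) (by rw [oddFlag_true hr]; decide) hcas
    rw [hmin] at h; push_cast at h; split_ifs at h ⊢ <;> linarith

/-- **`PathAccountingFirstPeriod`'s conclusion on `A5P1735`, EVERY sorted `b`, every direction `j`, depth `d < 2p`** (`N_p = 11`, `C⋆ ≤ 9`; node `-7` at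
`⌊d/p⌋ = 0`, `-6` at `⌊d/p⌋ = 1`). -/
theorem pathAccounting_profileA5P1735 (b : ℕ → ℤ) (j p : ℕ) (hb : InPolytope b) (hs : Sorted7 b) (hbj : InPolytope (shift b j))
    (hj1 : 1 ≤ j) (hj7 : j ≤ 7) (hprime : p.Prime) (hp5 : 5 ≤ p) (hwin : (b 0 + 2 : ℤ) < (p : ℤ) ^ 2) (hfp : FirstPeriod b p)
    (hA : b 6 < (p : ℤ)) (hA5 : (p : ℤ) ≤ b 5) (hL17 : (p : ℤ) + b 1 + b 7 ≤ b 0) (hL35 : (p : ℤ) + b 3 + b 5 ≤ b 0) (hS26 : b 0 < (p : ℤ) + b 2 + b 6) (hS34 : b 0 < (p : ℤ) + b 3 + b 4) (hd2 : dOf b < 2 * (p : ℤ))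
    (hcas : casoratian b j ≠ 0) :
    dOf b / (p : ℤ) - pairFloors b p - min (if 2 ≤ dOf b / (p : ℤ) then (1 : ℤ) else 0) (5 - (cStar b p : ℤ))
      ≤ padicValRat p (casoratian b j) := by
  obtain ⟨hF1, hF2⟩ := fp_bounds hfp
  have hp0 : (0 : ℤ) < p := by exact_mod_cast hprime.pos
  have hpf : pairFloors b p = 11 := by
    obtain ⟨h21, h32, h43, h54, h65, h76⟩ := sorted7_chain hs
    exact pairFloors_eq_11b hb hs hprime.pos hS26 hS34 hL17 hL35 hfp
  rw [hpf]
  have hC : (cStar b p : ℤ) ≤ 9 := by exact_mod_cast cStar_le_nine_A5P1735 hs hA hS26 hS34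
  have hfd : dOf b / (p : ℤ) < 2 := by rw [Int.ediv_lt_iff_lt_mul hp0]; linarith
  rw [if_neg (by omega)]
  have hmin : -4 ≤ min (0 : ℤ) (5 - (cStar b p : ℤ)) := le_min (by norm_num) (by linarith)
  have hlaw := cas_geA5P1735 hb hs hbj hj1 hj7 hprime hp5 hwin hA hA5 hL17 hL35 hS26 hS34 hF1 hF2 hcas
  by_cases h1 : (p : ℤ) ≤ dOf b
  · have hfd1 : dOf b / (p : ℤ) ≤ 1 := by omega
    rw [if_pos h1] at hlaw
    linarith
  · rw [if_neg h1] at hlaw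
    push Not at h1
    have hd0 : 0 ≤ dOf b := by have := hb.2.2; unfold dOf; linarith
    have hfd0 : dOf b / (p : ℤ) = 0 := Int.ediv_eq_zero_of_lt hd0 h1
    rw [hfd0]
    linarith

/-- **THE NODE ON `A5P1735` AT DEPTH `d < 2p`, EVERY SORTED `b`: `PathAccountingFirstPeriod` with its binders VERBATIM plus `b_6 < p ≤ b_5`, the profile's
ORDER conditions and `d < 2p`.** -/
theorem pathAccountingFirstPeriod_profileA5P1735 :
    ∀ (b : ℕ → ℤ) (p : ℕ), InPolytope b → Sorted7 b → InPolytope (shift b 7) →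
      p.Prime → 5 ≤ p → (b 0 + 2 : ℤ) < (p : ℤ) ^ 2 → FirstPeriod b p →
      b 6 < (p : ℤ) → (p : ℤ) ≤ b 5 → (p : ℤ) + b 1 + b 7 ≤ b 0 → (p : ℤ) + b 3 + b 5 ≤ b 0 → b 0 < (p : ℤ) + b 2 + b 6 → b 0 < (p : ℤ) + b 3 + b 4 → dOf b < 2 * (p : ℤ) → casoratian b 7 ≠ 0 →
        dOf b / (p : ℤ) - pairFloors b p - min (if 2 ≤ dOf b / (p : ℤ) then (1 : ℤ) else 0) (5 - (cStar b p : ℤ))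
          ≤ padicValRat p (casoratian b 7) :=
  fun b p hb hs hb7 hprime hp5 hwin hfp hA hA5 hL17 hL35 hS26 hS34 hd2 hcas =>
    pathAccounting_profileA5P1735 b 7 p hb hs hb7 (by norm_num) (by norm_num) hprime hp5 hwin hfp hA hA5 hL17 hL35 hS26 hS34 hd2 hcas

end A5P1735

/-! ## The a = 5 profile `A5P172635`: long pair blocks generated by [(1, 7), (2, 6), (3, 5)] (maximal short [(1, 6), (2, 5), (3, 4)]); `N_p = 12`, `C⋆ ≤ 9` -/

section A5P172635

variable {b : ℕ → ℤ} {j p : ℕ}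

/-- **The V-GAIN law on `A5P172635`, general `b`, every depth**: `v_p(Cas_j(b)) ≥ -7`, and `≥ -7` for `p ≤ d` (gen 10's `checkB` at `N = 6` and the
row check at `R = -2`, `decide`d on both covers; gen 23's `DenomLaw.vgainPal_of_cover`). -/
theorem cas_geA5P172635 (hb : InPolytope b) (hs : Sorted7 b) (hbj : InPolytope (shift b j)) (hj1 : 1 ≤ j) (hj7 : j ≤ 7)
    (hprime : p.Prime) (hp5 : 5 ≤ p) (hwin : (b 0 + 2 : ℤ) < (p : ℤ) ^ 2) (hA : b 6 < (p : ℤ)) (hA5 : (p : ℤ) ≤ b 5) (hL17 : (p : ℤ) + b 1 + b 7 ≤ b 0) (hL26 : (p : ℤ) + b 2 + b 6 ≤ b 0) (hL35 : (p : ℤ) + b 3 + b 5 ≤ b 0) (hS16 : b 0 < (p : ℤ) + b 1 + b 6) (hS25 : b 0 < (p : ℤ) + b 2 + b 5) (hS34 : b 0 < (p : ℤ) + b 3 + b 4)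
    (hF1 : b 1 < 2 * (p : ℤ)) (hF2 : b 0 < 2 * (p : ℤ) + b 6 + b 7) (hcas : casoratian b j ≠ 0) :
    -7 + (if (p : ℤ) ≤ dOf b then (0 : ℤ) else 0) ≤ padicValRat p (casoratian b j) := by
  haveI : Fact p.Prime := ⟨hprime⟩
  have hp2 : p % 2 = 1 := Nat.odd_iff.1 (hprime.odd_of_ne_two (by omega))
  obtain ⟨h21, h32, h43, h54, h65, h76⟩ := sorted7_chain hs
  obtain ⟨h0, hb1, hb2, hb3, hb4, hb5, hb6, hb7, hc1⟩ := box hb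
  have hpb : (p : ℤ) ≤ b 0 := by linarith
  have hmin : min (-2 : ℤ) 0 = -2 := by norm_num
  rcases Int.emod_two_eq_zero_or_one (b 0) with hr | hr
  · have h := vgainPal_of_cover hb hj1 hj7 hbj hp5 hpb hwin (coverA5P172635_ev hb hs hA hA5 hL17 hL26 hL35 hS16 hS25 hS34 hF1 hF2 hp5 hp2 hr) (N := 6) (by norm_num) ⟨3, rfl⟩
      (by rw [oddFlag_false hr]; decide) (-2) (by norm_num) (by rw [oddFlag_false hr]; decide) hcas
    rw [hmin] at h; push_cast at h; split_ifs at h ⊢ <;> linarith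
  · have h := vgainPal_of_cover hb hj1 hj7 hbj hp5 hpb hwin (coverA5P172635_od hb hs hA hA5 hL17 hL26 hL35 hS16 hS25 hS34 hF1 hF2 hp5 hp2 hr) (N := 6) (by norm_num) ⟨3, rfl⟩
      (by rw [oddFlag_true hr]; decide) (-2) (by norm_num) (by rw [oddFlag_true hr]; decide) hcas
    rw [hmin] at h; push_cast at h; split_ifs at h ⊢ <;> linarith

/-- **`PathAccountingFirstPeriod`'s conclusion on `A5P172635`, EVERY sorted `b`, every direction `j`, depth `d < 2p`** (`N_p = 12`, `C⋆ ≤ 9`; node `-8` at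
`⌊d/p⌋ = 0`, `-7` at `⌊d/p⌋ = 1`). -/
theorem pathAccounting_profileA5P172635 (b : ℕ → ℤ) (j p : ℕ) (hb : InPolytope b) (hs : Sorted7 b) (hbj : InPolytope (shift b j))
    (hj1 : 1 ≤ j) (hj7 : j ≤ 7) (hprime : p.Prime) (hp5 : 5 ≤ p) (hwin : (b 0 + 2 : ℤ) < (p : ℤ) ^ 2) (hfp : FirstPeriod b p)
    (hA : b 6 < (p : ℤ)) (hA5 : (p : ℤ) ≤ b 5) (hL17 : (p : ℤ) + b 1 + b 7 ≤ b 0) (hL26 : (p : ℤ) + b 2 + b 6 ≤ b 0) (hL35 : (p : ℤ) + b 3 + b 5 ≤ b 0) (hS16 : b 0 < (p : ℤ) + b 1 + b 6) (hS25 : b 0 < (p : ℤ) + b 2 + b 5) (hS34 : b 0 < (p : ℤ) + b 3 + b 4) (hd2 : dOf b < 2 * (p : ℤ))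
    (hcas : casoratian b j ≠ 0) :
    dOf b / (p : ℤ) - pairFloors b p - min (if 2 ≤ dOf b / (p : ℤ) then (1 : ℤ) else 0) (5 - (cStar b p : ℤ))
      ≤ padicValRat p (casoratian b j) := by
  obtain ⟨hF1, hF2⟩ := fp_bounds hfp
  have hp0 : (0 : ℤ) < p := by exact_mod_cast hprime.pos
  have hpf : pairFloors b p = 12 := by
    obtain ⟨h21, h32, h43, h54, h65, h76⟩ := sorted7_chain hs
    exact pairFloors_eq_12e hb hs hprime.pos hS16 hS25 hS34 hL17 hL26 hL35 hfp
  rw [hpf]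
  have hC : (cStar b p : ℤ) ≤ 9 := by exact_mod_cast cStar_le_nine_A5P172634 hs hA hS16 hS25
  have hfd : dOf b / (p : ℤ) < 2 := by rw [Int.ediv_lt_iff_lt_mul hp0]; linarith
  rw [if_neg (by omega)]
  have hmin : -4 ≤ min (0 : ℤ) (5 - (cStar b p : ℤ)) := le_min (by norm_num) (by linarith)
  have hlaw := cas_geA5P172635 hb hs hbj hj1 hj7 hprime hp5 hwin hA hA5 hL17 hL26 hL35 hS16 hS25 hS34 hF1 hF2 hcas
  by_cases h1 : (p : ℤ) ≤ dOf b
  · have hfd1 : dOf b / (p : ℤ) ≤ 1 := by omega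
    rw [if_pos h1] at hlaw
    linarith
  · rw [if_neg h1] at hlaw
    push Not at h1
    have hd0 : 0 ≤ dOf b := by have := hb.2.2; unfold dOf; linarith
    have hfd0 : dOf b / (p : ℤ) = 0 := Int.ediv_eq_zero_of_lt hd0 h1
    rw [hfd0]
    linarith

/-- **THE NODE ON `A5P172635` AT DEPTH `d < 2p`, EVERY SORTED `b`: `PathAccountingFirstPeriod` with its binders VERBATIM plus `b_6 < p ≤ b_5`, the profile's
ORDER conditions and `d < 2p`.** -/
theorem pathAccountingFirstPeriod_profileA5P172635 :
    ∀ (b : ℕ → ℤ) (p : ℕ), InPolytope b → Sorted7 b → InPolytope (shift b 7) →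
      p.Prime → 5 ≤ p → (b 0 + 2 : ℤ) < (p : ℤ) ^ 2 → FirstPeriod b p →
      b 6 < (p : ℤ) → (p : ℤ) ≤ b 5 → (p : ℤ) + b 1 + b 7 ≤ b 0 → (p : ℤ) + b 2 + b 6 ≤ b 0 → (p : ℤ) + b 3 + b 5 ≤ b 0 → b 0 < (p : ℤ) + b 1 + b 6 → b 0 < (p : ℤ) + b 2 + b 5 → b 0 < (p : ℤ) + b 3 + b 4 → dOf b < 2 * (p : ℤ) → casoratian b 7 ≠ 0 →
        dOf b / (p : ℤ) - pairFloors b p - min (if 2 ≤ dOf b / (p : ℤ) then (1 : ℤ) else 0) (5 - (cStar b p : ℤ))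
          ≤ padicValRat p (casoratian b 7) :=
  fun b p hb hs hb7 hprime hp5 hwin hfp hA hA5 hL17 hL26 hL35 hS16 hS25 hS34 hd2 hcas =>
    pathAccounting_profileA5P172635 b 7 p hb hs hb7 (by norm_num) (by norm_num) hprime hp5 hwin hfp hA hA5 hL17 hL26 hL35 hS16 hS25 hS34 hd2 hcas

end A5P172635

end Summit.KontsevichZagierPeriods.Zeta5Search.FullProfile
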